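import Summits.BirchSwinnertonDyer.BirchSwinnertonDyer.Theorems.ResidualThetaTransportAtTwoSignedMuVanishingAtTwoPlusOldClassFlat
import HarnessLib

/-!
# Route `ThetaPartnerAtTwo`, crux K2r0P `SignedMainConjectureCMTwoRankZeroOfPub` (stmt-BirchSwinnertonDyer-24945),
# line `rankzero` v14, stub (μ♭)_A: the HECKE SUM AT A GOOD ODD PRIME read modulo 2 — the symbol algebra behind
# the quadratic-twist transport of FLAT at `p = 2`

Cell `bsd-wall`, width seat `bsd-wall-tp2-p2-w3` (g2). THEOREMS ONLY (no `def`, no named fact, no `sorry`); pure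
modular-symbol algebra for ONE rational newform; helper `--supports` the crux; BSD is not proved by any of this.

Let `g` be a normalised newform of level `N` with rational coefficients, `ℓ ∤ N` a prime with `a_ℓ(g) = a`, and write
`[y] = [y]⁺_g` (`ratPlusSymbol`), `I(y) = 2([y] − [0])` — an INTEGER whenever `den y` is prime to `N` (Manin; tree
`exists_two_mul_ratPlusSymbol_sub_eq_intCast`). The Hecke relation at `ℓ` (Mazur–Tate–Teitelbaum (4.2), tree
`intCast_mul_ratPlusSymbol`) read at `ℓx` is the TRANSLATION SUM

* §2 `sum_ratPlusSymbol_add_div_eq`: `∑_{b mod ℓ} [x + b/ℓ] = a·[ℓx] − [ℓ²x]` (all `x ∈ ℚ`).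

For a weight `ε : ℤ/ℓ → ℤ` which is EVEN at `0` and ODD elsewhere — the shape of a quadratic character of conductor `ℓ`
(Legendre symbol `(b/ℓ) ∈ {0, ±1}`), `ε ≡ 𝟙_{b ≠ 0} (mod 2)` — the `ε`-twisted sum of doubled symbol differences is
therefore congruent modulo `2ℤ` to an explicit three-term combination of DILATES:

* §3 `exists_int_twistedSum_eq`: for `den x` prime to `N`,
  `∑_b ε(b)·(2[x + b/ℓ] − 2[b/ℓ]) = I(x) + a·I(ℓx) + I(ℓ²x) + 2z` with `z ∈ ℤ`
  (the `b = 0` term and the constants `∑_{b≠0} I(b/ℓ)` cancel in pairs; no hypothesis on `a₂`).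

This is the mod-`2` shadow of «twisting by a quadratic character = depleting by the Euler factor at `ℓ`»
(`f_χ ⊗ χ = f^{[ℓ]}`; Emerton–Pollack–Weston's unit content of Euler factors): by Birch's lemma
(`exists_ratPlusSymbol_twist_eq_sum_and_sq`) the left side is, up to the period constant, the doubled plus symbol of
the TWISTED newform, so the sequel `…FlatTwist` transports «some `2([b/4^k]⁺ − [0]⁺)` is odd» (= FLAT at `2`, RTT
`SignedMuAtTwo.*`) between a habitat curve and its real quadratic twists.

References: B. Mazur, J. Tate, J. Teitelbaum, Invent. Math. 84 (1986) §I.4 (4.2), §I.8 [MazurTateTeitelbaum1986Invent];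
M. Emerton, R. Pollack, T. Weston, Invent. Math. 163 (2006) Lemma 4.4.4 [EmertonPollackWeston2006]; J. E. Cremona,
*Algorithms for modular elliptic curves* (1997) §2.8 [CremonaAlgorithms1997].
-/

set_option autoImplicit false
-- the Theorems namespace of this sub repeats the summit name by design (D-0017 nested layout)
set_option linter.dupNamespace false

noncomputable section

open scoped Classical MatrixGroups ModularForm

open CongruenceSubgroup Literature.NumberTheory.EllipticCurves Literature.NumberTheory.EllipticCurves.ModularForms

namespace Summit.BirchSwinnertonDyer.BirchSwinnertonDyer.Theorems.FlatTwist

/-! ## §1. Denominators prime to the level -/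

section Denominators

/-- `den(x + n/ℓ)` is prime to `N` when `den x` and `ℓ` are. [folklore] -/
theorem coprime_den_add_natCast_div {x : ℚ} {N ℓ : ℕ} (hx : x.den.Coprime N) (hℓ : ℓ.Coprime N) (n : ℕ) :
    (x + (n : ℚ) / ℓ).den.Coprime N := by
  have h1 : ((n : ℚ) / ℓ).den ∣ ℓ := by
    have h : ((n : ℚ) / ℓ) = Rat.divInt n ℓ := by rw [Rat.divInt_eq_div]; push_cast; rfl
    have hd := Rat.den_dvd (n : ℤ) (ℓ : ℤ)
    rw [← h] at hd
    exact_mod_cast hd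
  exact Nat.Coprime.coprime_dvd_left (Rat.add_den_dvd _ _)
    (Nat.Coprime.mul_left hx (Nat.Coprime.coprime_dvd_left h1 hℓ))

/-- `den(n/ℓ)` is prime to `N` when `ℓ` is. [folklore] -/
theorem coprime_den_natCast_div {N ℓ : ℕ} (hℓ : ℓ.Coprime N) (n : ℕ) : ((n : ℚ) / ℓ).den.Coprime N := by
  have h := coprime_den_add_natCast_div (x := 0) (by simp) hℓ n
  rwa [zero_add] at h

/-- `den(n·x)` is prime to `N` when `den x` is. [folklore] -/
theorem coprime_den_natCast_mul {x : ℚ} {N : ℕ} (hx : x.den.Coprime N) (n : ℕ) : ((n : ℚ) * x).den.Coprime N := by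
  have h : ((n : ℚ) * x).den ∣ (n : ℚ).den * x.den := Rat.mul_den_dvd _ _
  rw [Rat.den_natCast, one_mul] at h
  exact Nat.Coprime.coprime_dvd_left h hx

end Denominators

/-! ## §2. The translation sum `∑_{b mod ℓ} [x + b/ℓ]⁺ = a_ℓ·[ℓx]⁺ − [ℓ²x]⁺` -/

section Hecke

variable {N : ℕ} [NeZero N] (g : CuspForm (Gamma0 N) 2)

omit [NeZero N] in
/-- A sum over `ZMod ℓ` read through `val` is the sum over `range ℓ`. [folklore] -/
theorem sum_zmod_val_eq_sum_range {ℓ : ℕ} [NeZero ℓ] (F : ℕ → ℚ) :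
    ∑ b : ZMod ℓ, F b.val = ∑ j ∈ Finset.range ℓ, F j := by
  obtain ⟨k, rfl⟩ : ∃ k, ℓ = k + 1 := ⟨ℓ - 1, (Nat.succ_pred_eq_of_ne_zero (NeZero.ne ℓ)).symm⟩
  exact Fin.sum_univ_eq_sum_range F (k + 1)

/-- **The translation sum** (Hecke at a good prime `ℓ`, `a_ℓ(g) = a`, read at `ℓx`):
`∑_{b mod ℓ} [x + b/ℓ]⁺_g = a·[ℓx]⁺_g − [ℓ²x]⁺_g` for every `x ∈ ℚ` (the `ℓ` matrices `(1 j; 0 ℓ)` act on `ℓx` by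
`(ℓx + j)/ℓ = x + j/ℓ`). [cite: MazurTateTeitelbaum1986Invent, §I.4 (4.2)] -/
theorem sum_ratPlusSymbol_add_div_eq (hg : IsNewform0 g) (hQ : coeffField g = ⊥) {ℓ : ℕ} [NeZero ℓ]
    (hℓ : ℓ.Prime) (hℓN : ¬ ℓ ∣ N) {a : ℤ} (ha : cuspCoeff g ℓ = a) (x : ℚ) :
    ∑ b : ZMod ℓ, ratPlusSymbol g (x + (b.val : ℚ) / ℓ) =
      a * ratPlusSymbol g (ℓ * x) - ratPlusSymbol g ((ℓ : ℚ) ^ 2 * x) := by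
  have hℓ0 : (ℓ : ℚ) ≠ 0 := by exact_mod_cast hℓ.ne_zero
  have h := intCast_mul_ratPlusSymbol ℓ hg hℓ hℓN ha (ratCast_ratPlusSymbol_holds hg hQ) ((ℓ : ℚ) * x)
  have e1 : ∑ j : Fin ℓ, ratPlusSymbol g (((ℓ : ℚ) * x + j) / ℓ) =
      ∑ j ∈ Finset.range ℓ, ratPlusSymbol g (x + (j : ℚ) / ℓ) := by
    rw [Fin.sum_univ_eq_sum_range (fun j ↦ ratPlusSymbol g (((ℓ : ℚ) * x + j) / ℓ)) ℓ]
    refine Finset.sum_congr rfl fun j _ ↦ ?_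
    congr 1
    field_simp
  have e2 : ∑ b : ZMod ℓ, ratPlusSymbol g (x + (b.val : ℚ) / ℓ) =
      ∑ j ∈ Finset.range ℓ, ratPlusSymbol g (x + (j : ℚ) / ℓ) :=
    sum_zmod_val_eq_sum_range (fun j ↦ ratPlusSymbol g (x + (j : ℚ) / ℓ))
  have e3 : (ℓ : ℚ) * ((ℓ : ℚ) * x) = (ℓ : ℚ) ^ 2 * x := by ring
  rw [e1, e3] at h
  rw [e2]
  linear_combination -h

/-- At `x = 0`: `∑_{b mod ℓ} [b/ℓ]⁺_g = (a − 1)·[0]⁺_g`. [cite: MazurTateTeitelbaum1986Invent, §I.4 (4.2)] -/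
theorem sum_ratPlusSymbol_div_eq (hg : IsNewform0 g) (hQ : coeffField g = ⊥) {ℓ : ℕ} [NeZero ℓ]
    (hℓ : ℓ.Prime) (hℓN : ¬ ℓ ∣ N) {a : ℤ} (ha : cuspCoeff g ℓ = a) :
    ∑ b : ZMod ℓ, ratPlusSymbol g ((b.val : ℚ) / ℓ) = (a - 1) * ratPlusSymbol g 0 := by
  have h := sum_ratPlusSymbol_add_div_eq g hg hQ hℓ hℓN ha 0
  simp only [zero_add, mul_zero] at h
  rw [h]
  ring

end Hecke

/-! ## §3. The `ε`-twisted sum of doubled symbol differences modulo `2ℤ` -/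

section Twisted

variable {N : ℕ} [NeZero N] (g : CuspForm (Gamma0 N) 2)

/-- **Twisted sum ≡ Euler-factor dilates (mod 2).** For a normalised newform `g` of level `N` with rational coefficients,
a prime `ℓ ∤ N` with `a_ℓ(g) = a`, a weight `ε : ℤ/ℓ → ℤ` with `ε(b) ≡ 𝟙_{b ≠ 0} (mod 2)` (e.g. the Legendre symbol mod `ℓ`),
and `x ∈ ℚ` with `den x` prime to `N`:
`∑_{b mod ℓ} ε(b)·(2[x + b/ℓ]⁺ − 2[b/ℓ]⁺) = I(x) + a·I(ℓx) + I(ℓ²x) + 2z` for some `z ∈ ℤ`, where `I(y) = 2([y]⁺ − [0]⁺)`.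
Proof: every `I(y)` in sight is an integer; modulo `2`, `ε` is the indicator of `b ≠ 0`, and the two translation sums
(§2 at `x` and at `0`) give `∑_b I(x + b/ℓ) − ∑_b I(b/ℓ) = a·I(ℓx) − I(ℓ²x)`; the `b = 0` terms are `I(x)` and `I(0) = 0`.
[cite: MazurTateTeitelbaum1986Invent, §I.4 (4.2) and §I.8] [cite: EmertonPollackWeston2006, Lemma 4.4.4] -/
theorem exists_int_twistedSum_eq (hg : IsNewform0 g) (hQ : coeffField g = ⊥) {ℓ : ℕ} [NeZero ℓ]
    (hℓ : ℓ.Prime) (hℓN : ¬ ℓ ∣ N) {a : ℤ} (ha : cuspCoeff g ℓ = a) (ε : ZMod ℓ → ℤ)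
    (hε : ∀ b, ∃ t : ℤ, ε b = (if b = 0 then 0 else 1) + 2 * t) {x : ℚ} (hx : x.den.Coprime N) :
    ∃ z : ℤ, ∑ b : ZMod ℓ, (ε b : ℚ) *
        (2 * ratPlusSymbol g (x + (b.val : ℚ) / ℓ) - 2 * ratPlusSymbol g ((b.val : ℚ) / ℓ)) =
      2 * (ratPlusSymbol g x - ratPlusSymbol g 0) + a * (2 * (ratPlusSymbol g (ℓ * x) - ratPlusSymbol g 0)) +
        2 * (ratPlusSymbol g ((ℓ : ℚ) ^ 2 * x) - ratPlusSymbol g 0) + 2 * z := by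
  have hreal : ∀ n, (cuspCoeff g n).im = 0 := cuspCoeff_im_eq_zero_of_coeffField_eq_bot hQ
  have hℓN' : ℓ.Coprime N := (Nat.Prime.coprime_iff_not_dvd hℓ).mpr hℓN
  -- integer values of the doubled symbol differences
  choose i hi using fun b : ZMod ℓ ↦
    SignedMuAtTwo.exists_two_mul_ratPlusSymbol_sub_eq_intCast g hreal (coprime_den_add_natCast_div hx hℓN' b.val)
  choose j hj using fun b : ZMod ℓ ↦
    SignedMuAtTwo.exists_two_mul_ratPlusSymbol_sub_eq_intCast g hreal (coprime_den_natCast_div hℓN' b.val)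
  choose t ht using hε
  obtain ⟨v, hv⟩ := SignedMuAtTwo.exists_two_mul_ratPlusSymbol_sub_eq_intCast g hreal (coprime_den_natCast_mul hx ℓ)
  obtain ⟨w, hw⟩ := SignedMuAtTwo.exists_two_mul_ratPlusSymbol_sub_eq_intCast g hreal
    (coprime_den_natCast_mul hx (ℓ ^ 2))
  -- the `b = 0` terms
  have hi0 : (i 0 : ℚ) = 2 * (ratPlusSymbol g x - ratPlusSymbol g 0) := by
    rw [← hi 0, ZMod.val_zero, Nat.cast_zero, zero_div, add_zero]
  have hj0 : (j 0 : ℚ) = 0 := by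
    rw [← hj 0, ZMod.val_zero, Nat.cast_zero, zero_div, sub_self, mul_zero]
  -- the two translation sums
  have hS1 := sum_ratPlusSymbol_add_div_eq g hg hQ hℓ hℓN ha x
  have hS0 := sum_ratPlusSymbol_div_eq g hg hQ hℓ hℓN ha
  have hcard : (Finset.univ : Finset (ZMod ℓ)).card = ℓ := by rw [Finset.card_univ, ZMod.card]
  have hsumI : ∑ b : ZMod ℓ, (i b : ℚ) = 2 * (a * ratPlusSymbol g (ℓ * x) - ratPlusSymbol g ((ℓ : ℚ) ^ 2 * x)) -
      2 * ℓ * ratPlusSymbol g 0 := by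
    have h : ∑ b : ZMod ℓ, (i b : ℚ) =
        ∑ b : ZMod ℓ, (2 * ratPlusSymbol g (x + (b.val : ℚ) / ℓ) - 2 * ratPlusSymbol g 0) :=
      Finset.sum_congr rfl fun b _ ↦ by rw [← hi b]; ring
    rw [h, Finset.sum_sub_distrib, ← Finset.mul_sum, hS1, Finset.sum_const, hcard, nsmul_eq_mul]
    ring
  have hsumJ : ∑ b : ZMod ℓ, (j b : ℚ) = 2 * ((a - 1) * ratPlusSymbol g 0) - 2 * ℓ * ratPlusSymbol g 0 := by
    have h : ∑ b : ZMod ℓ, (j b : ℚ) =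
        ∑ b : ZMod ℓ, (2 * ratPlusSymbol g ((b.val : ℚ) / ℓ) - 2 * ratPlusSymbol g 0) :=
      Finset.sum_congr rfl fun b _ ↦ by rw [← hj b]; ring
    rw [h, Finset.sum_sub_distrib, ← Finset.mul_sum, hS0, Finset.sum_const, hcard, nsmul_eq_mul]
    ring
  have hpw : ((ℓ ^ 2 : ℕ) : ℚ) * x = (ℓ : ℚ) ^ 2 * x := by push_cast; ring
  rw [hpw] at hw
  -- each summand through the integers `i b`, `j b`, `t b`
  have hterm : ∀ b : ZMod ℓ, (ε b : ℚ) *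
      (2 * ratPlusSymbol g (x + (b.val : ℚ) / ℓ) - 2 * ratPlusSymbol g ((b.val : ℚ) / ℓ)) =
      ((if b = 0 then (0 : ℚ) else 1) * ((i b : ℚ) - j b)) + 2 * ((t b : ℚ) * ((i b : ℚ) - j b)) := by
    intro b
    have h2 : 2 * ratPlusSymbol g (x + (b.val : ℚ) / ℓ) - 2 * ratPlusSymbol g ((b.val : ℚ) / ℓ) =
        (i b : ℚ) - j b := by rw [← hi b, ← hj b]; ring
    rw [h2, ht b]
    push_cast
    split_ifs <;> ring
  rw [Finset.sum_congr rfl fun b _ ↦ hterm b, Finset.sum_add_distrib, ← Finset.mul_sum]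
  -- the indicator sum: `∑_b 𝟙_{b ≠ 0}·(i_b − j_b) = ∑_b (i_b − j_b) − (i_0 − j_0)`
  have hind : ∑ b : ZMod ℓ, (if b = 0 then (0 : ℚ) else 1) * ((i b : ℚ) - j b) =
      ∑ b : ZMod ℓ, ((i b : ℚ) - j b) - ((i 0 : ℚ) - j 0) := by
    have h : ∀ b : ZMod ℓ, (if b = 0 then (0 : ℚ) else 1) * ((i b : ℚ) - j b) =
        ((i b : ℚ) - j b) - (if b = 0 then ((i b : ℚ) - j b) else 0) := by
      intro b; split_ifs <;> ring
    rw [Finset.sum_congr rfl fun b _ ↦ h b, Finset.sum_sub_distrib, Finset.sum_ite_eq']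
    simp
  rw [hind, Finset.sum_sub_distrib, hsumI, hsumJ, hi0, hj0]
  refine ⟨∑ b : ZMod ℓ, t b * (i b - j b) - w - i 0, ?_⟩
  push_cast
  rw [← hw, hi0]
  ring

end Twisted

end Summit.BirchSwinnertonDyer.BirchSwinnertonDyer.Theorems.FlatTwist

end
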